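import Summits.QuantumFields.YangMills.Theorems.ForcedResponseSkewnessResponseLocalisationFarSmear
import HarnessLib

/-!
# Crux `ResponseLocalisation` (repaired item stmt-QuantumFields-24293), route `ForcedResponseSkewness`:
# the re-cut far-field stub REDUCED to a third-cumulant triangle majorant

Support file (`--supports stmt-QuantumFields-24293`) of the width prover `ym-line-frs-p2` (lead `ym-line-frs-p1`).  The
planner's repaired BC3 skeleton (`bc/line1r/ResponseLocalisation_repair_birth.lean`, ns `…ResponseLocalisation.Repair`)
re-cuts the far-field stub as
`stub_far : ∀ G r a (p ρ ε) v ⊆ closedBall p ρ ∩ {0<y₀}, ∫|v| ≤ 1, floor ε ⇒ ∀ η Λ ∃ D β₆ Λ₆ ∀ β ≥ β₆, aβ·L ≥ Λ₆, l ∈ [1,Λ]: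
 Σ_x 𝟙{D < ‖l aβ x‖} |respM_{β,L,l aβ}(x)| ≤ η (1 + |∂_cQ2|)` — physics AND analysis in one statement.  This file proves
the analysis and isolates the physics:

* `exists_wall_gap` — a source with `tsupport v ⊆ closedBall p ρ ∩ {0 < y₀}` has a positive wall gap `g` (`v w ≠ 0 ⇒ g ≤ w₀`)
  and radius `R₀ = ‖p‖ + ρ` (compactness; `θ` is a time-reversing isometry for the reflected source);
* `far_ceiling_of_gap` — per-source ε-form of `Far.far_sum_abs_smear_le`: given the gap data, `A ≥ 0`, `η > 0`, there are
  `D > 0` and a spacing threshold `s₀ > 0` with `Σ_x 𝟙{D<‖s x‖}|respM_{β,L,s}(x)| ≤ η` for all `0 < s ≤ s₀`, tori `2R₀ ≤ s L`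
  and every `β` at which `torusK3_{β,L}` obeys the triangle majorant with constant `A` (Riemann sums by the width seat p3's
  `exists_latticeSum_abs_le`);
* `stub_far_of_farKernel` — **the registered re-cut `stub_far` text follows from the FAR KERNEL HYPOTHESIS**
  «for every compact simple `G`, `r`, unit `a → 0⁺` pinned by some compactly supported positive-time floor witness:
  `∃ A β₀ Λ₀, ∀ β ≥ β₀, ∀ L, Λ₀ ≤ aβ·L → |torusK3_{β,L}(x,y,z)| ≤ A (1+d_T(x,y))⁻⁴(1+d_T(x,z))⁻⁴(1+d_T(y,z))⁻⁴` on the box»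
  (an E0′-type third-cumulant ceiling WITH pairwise hyperscaling decay, uniform on tori larger than the unit; beyond the
  landed scale-free `MomentBounds6`; engine-grade, NOT proved here).  Thresholds: `β₆` from `a → 0` (`Λ·aβ ≤ min s₀ 1`) and
  `β₀`; `Λ₆ = max Λ₀ (2R₀)`; the relative tolerance `η(1+|∂_cQ2|) ≥ η` is not needed by the far part.

Honest label: reduces ONE stub of a CONDITIONAL rung line (leaf R2a `BalabanLadder.NT`) to a named physics input; the crux,
NT and the route stay open; nothing here bears on the Yang–Mills mass gap, which is NOT proved by any of this.
-/

set_option autoImplicit false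

noncomputable section

namespace Summit.QuantumFields.YangMills.Cruxes.ResponseLocalisation.Far

open Set Metric Filter Topology Finset MeasureTheory
open scoped SchwartzMap
open Literature.MathematicalPhysics.QuantumLattice Literature.Probability.LatticeModels
open Literature.MathematicalPhysics.QuantumFieldTheory
open Summit.QuantumFields.YangMills.Cruxes.RunningCouplingCeiling.Pointwise
open Summit.QuantumFields.YangMills.Cruxes.OSLegsFromFemtoAndGap.DlrCollarTransfer
open Summit.QuantumFields.YangMills.Cruxes.ResponseLocalisation.Birth

/-! ### Wall gap and radius of a compactly supported positive-time source -/

/-- **Wall gap and radius.**  If `tsupport v ⊆ closedBall p ρ ∩ {0 < y₀}` then, with `R₀ = ‖p‖ + ρ`, there is `g > 0` such that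
`v w ≠ 0 ⇒ ‖w‖ ≤ R₀ ∧ g ≤ w₀` and `θv w ≠ 0 ⇒ ‖w‖ ≤ R₀ ∧ w₀ ≤ −g` (the compact support has a least time coordinate, which
is positive; `θ` is an isometry reversing time). [folklore] -/
theorem exists_wall_gap (v : 𝓢(EuclideanSpace ℝ (Fin 4), ℝ)) {p : EuclideanSpace ℝ (Fin 4)} {ρ : ℝ}
    (hball : tsupport (v : EuclideanSpace ℝ (Fin 4) → ℝ) ⊆ Metric.closedBall p ρ)
    (hsupp : tsupport (v : EuclideanSpace ℝ (Fin 4) → ℝ) ⊆ {y : EuclideanSpace ℝ (Fin 4) | 0 < y 0}) :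
    ∃ g : ℝ, 0 < g ∧
      (∀ w, v w ≠ 0 → ‖w‖ ≤ ‖p‖ + ρ ∧ g ≤ w 0) ∧
      (∀ w, (thetaTest 4 v) w ≠ 0 → ‖w‖ ≤ ‖p‖ + ρ ∧ w 0 ≤ -g) := by
  have hK : IsCompact (tsupport (v : EuclideanSpace ℝ (Fin 4) → ℝ)) :=
    (isCompact_closedBall p ρ).of_isClosed_subset (isClosed_tsupport _) hball
  have hcont : Continuous fun w : EuclideanSpace ℝ (Fin 4) => w 0 := by fun_prop
  -- the gap: least time coordinate on the support (or `1` if the support is empty)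
  have hgap : ∃ g : ℝ, 0 < g ∧ ∀ w, v w ≠ 0 → g ≤ w 0 := by
    by_cases hne : (tsupport (v : EuclideanSpace ℝ (Fin 4) → ℝ)).Nonempty
    · obtain ⟨w₀, hw₀, hmin⟩ := hK.exists_isMinOn hne hcont.continuousOn
      refine ⟨w₀ 0, hsupp hw₀, fun w hw => ?_⟩
      exact hmin (subset_tsupport _ (Function.mem_support.2 hw))
    · refine ⟨1, one_pos, fun w hw => ?_⟩
      exact absurd ⟨w, subset_tsupport _ (Function.mem_support.2 hw)⟩ hne
  obtain ⟨g, hg, hgw⟩ := hgap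
  have hrad : ∀ w, v w ≠ 0 → ‖w‖ ≤ ‖p‖ + ρ := fun w hw => (norm_le_of_apply_ne_zero v hball hw).1
  refine ⟨g, hg, fun w hw => ⟨hrad w hw, hgw w hw⟩, fun w hw => ?_⟩
  rw [thetaTest_apply] at hw
  have h1 := hrad _ hw
  have h2 := hgw _ hw
  rw [LinearIsometryEquiv.norm_map] at h1
  have h3 : (timeReflection 4 w) 0 = -(w 0) := by simp [timeReflection_apply]
  rw [h3] at h2
  exact ⟨h1, by linarith⟩

/-! ### Per-source ε-form of the far-field ceiling -/

section PerSource

variable (G : Type) [Group G] [TopologicalSpace G] [IsTopologicalGroup G] [CompactSpace G]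
  [MeasurableSpace G] [BorelSpace G] (r : LatticeRep G)

/-- **Far-field ceiling, per source.**  For a real Schwartz `v` with `tsupport v ⊆ closedBall p ρ ∩ {0 < y₀}`, a majorant
constant `A ≥ 0` and `η > 0` there are a physical radius `D > 0` and a spacing threshold `s₀ > 0` such that for all
`0 < s ≤ s₀`, all tori with `2(‖p‖+ρ) ≤ s·L` and every `β` at which the torus third cumulant obeys the triangle majorant with
constant `A`, the far mass of the response profile is `≤ η` (here `D` may depend on `v`, through `‖v‖₁` and the wall gap). -/
theorem far_ceiling_of_gap (v : 𝓢(EuclideanSpace ℝ (Fin 4), ℝ)) {p : EuclideanSpace ℝ (Fin 4)} {ρ : ℝ}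
    (hball : tsupport (v : EuclideanSpace ℝ (Fin 4) → ℝ) ⊆ Metric.closedBall p ρ)
    (hsupp : tsupport (v : EuclideanSpace ℝ (Fin 4) → ℝ) ⊆ {y : EuclideanSpace ℝ (Fin 4) | 0 < y 0})
    {A : ℝ} (hA : 0 ≤ A) {η : ℝ} (hη : 0 < η) :
    ∃ D : ℝ, 0 < D ∧ ∃ s₀ : ℝ, 0 < s₀ ∧ ∀ s : ℝ, 0 < s → s ≤ s₀ → ∀ L : ℕ, 2 * (‖p‖ + ρ) ≤ s * L →
      ∀ β : ℝ,
        (∀ x ∈ box 4 L, ∀ y ∈ box 4 L, ∀ z ∈ box 4 L,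
          |torusK3 G r β L x y z| ≤
            A * (((1 + torusDist L x y) ^ 4)⁻¹ * ((1 + torusDist L x z) ^ 4)⁻¹ *
              ((1 + torusDist L y z) ^ 4)⁻¹)) →
        ∑ x ∈ box 4 L, (if D < ‖s • siteToE x‖ then |respM G r β L s v x| else 0) ≤ η := by
  obtain ⟨g, hg, hv', hθ'⟩ := exists_wall_gap v hball hsupp
  set R₀ : ℝ := ‖p‖ + ρ with hR₀
  set N : ℝ := (∫ y, |v y|) + 1 with hN
  have hN0 : 0 < N := by
    have : 0 ≤ ∫ y, |v y| := integral_nonneg fun _ => abs_nonneg _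
    rw [hN]; linarith
  set D : ℝ := max (max 2 (2 * R₀ + 1)) (2 ^ 14 * A * N ^ 2 / (g ^ 4 * η) + 1) with hD
  have hD2 : 2 ≤ D := le_trans (le_max_left _ _) (le_max_left _ _)
  have hDR : 2 * R₀ + 1 ≤ D := le_trans (le_max_right _ _) (le_max_left _ _)
  have hDA : 2 ^ 14 * A * N ^ 2 / (g ^ 4 * η) < D := lt_of_lt_of_le (lt_add_one _) (le_max_right _ _)
  have hD0 : 0 < D := by linarith
  -- Riemann sums of both sources
  have hvR : tsupport (v : EuclideanSpace ℝ (Fin 4) → ℝ) ⊆ Metric.closedBall 0 R₀ := by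
    refine hball.trans (Metric.closedBall_subset_closedBall' ?_)
    rw [hR₀, dist_zero_right]; linarith
  have hθR := Summit.QuantumFields.YangMills.Cruxes.NT.Reference.tsupport_thetaTest_subset_closedBall_zero hvR
  obtain ⟨s₁, hs₁, h₁⟩ := exists_latticeSum_abs_le v hvR
  obtain ⟨s₂, hs₂, h₂⟩ := exists_latticeSum_abs_le (thetaTest 4 v) hθR
  refine ⟨D, hD0, min (min s₁ s₂) 1, by positivity, fun s hs hss₀ L hL β hK => ?_⟩
  have hs1 : s ≤ 1 := le_trans hss₀ (min_le_right _ _)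
  have hss₁ : s ≤ s₁ := le_trans hss₀ (le_trans (min_le_left _ _) (min_le_left _ _))
  have hss₂ : s ≤ s₂ := le_trans hss₀ (le_trans (min_le_left _ _) (min_le_right _ _))
  have hRL : R₀ ≤ s * L := by
    have : 0 ≤ s * L := by positivity
    by_cases hR : 0 ≤ R₀ <;> linarith
  have hSv : s ^ 4 * ∑ z ∈ box 4 L, |v (s • siteToE z)| ≤ N := h₁ s hs hss₁ L hRL
  have hSθ : s ^ 4 * ∑ y ∈ box 4 L, |(thetaTest 4 v) (s • siteToE y)| ≤ N := by
    have := h₂ s hs hss₂ L hRL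
    rwa [Summit.QuantumFields.YangMills.Cruxes.NT.CeilingPrice.integral_abs_thetaTest] at this
  -- the abstract far-field smearing theorem with the gap data of `v`
  have hmain := far_sum_abs_smear_le L hs hs1 (fun w => (thetaTest 4 v) w) (fun w => v w)
    (R₀ := R₀) (g := g) hg (fun w hw => (hθ' w hw).1) (fun w hw => (hv' w hw).1)
    (fun w hw => (hθ' w hw).2) (fun w hw => (hv' w hw).2) hL (torusK3 G r β L) hA hK hD2 hDR
  have hSθ0 : 0 ≤ s ^ 4 * ∑ y ∈ box 4 L, |(thetaTest 4 v) (s • siteToE y)| := by positivity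
  have hSv0 : 0 ≤ s ^ 4 * ∑ z ∈ box 4 L, |v (s • siteToE z)| := by positivity
  have hcoef0 : 0 ≤ 2 ^ 14 * A / (g ^ 4 * D) := by positivity
  rw [← Finset.sum_filter]
  calc ∑ x ∈ (box 4 L).filter (fun x : Site 4 => D < ‖s • siteToE x‖), |respM G r β L s v x|
      = ∑ x ∈ (box 4 L).filter (fun x : Site 4 => D < ‖s • siteToE x‖),
          |∑ y ∈ box 4 L, ∑ z ∈ box 4 L,
            (thetaTest 4 v) (s • siteToE y) * v (s • siteToE z) * torusK3 G r β L x y z| := by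
        simp only [respM]
    _ ≤ 2 ^ 14 * A / (g ^ 4 * D) * (s ^ 4 * ∑ y ∈ box 4 L, |(thetaTest 4 v) (s • siteToE y)|) *
          (s ^ 4 * ∑ z ∈ box 4 L, |v (s • siteToE z)|) := hmain
    _ ≤ 2 ^ 14 * A / (g ^ 4 * D) * N * N :=
        mul_le_mul (mul_le_mul_of_nonneg_left hSθ hcoef0) hSv hSv0 (by positivity)
    _ = 2 ^ 14 * A * N ^ 2 / (g ^ 4 * D) := by ring
    _ ≤ η := by
        rw [div_le_iff₀ (by positivity)]
        have h1 : 2 ^ 14 * A * N ^ 2 < D * (g ^ 4 * η) := by rwa [div_lt_iff₀ (by positivity)] at hDA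
        nlinarith

end PerSource

/-! ### The registered re-cut far-field stub from the far kernel hypothesis -/

/-- **The re-cut `stub_far` of the repaired skeleton follows from the FAR KERNEL HYPOTHESIS** (a torus-uniform triangle
majorant for the third cumulant of the action densities along a pinned unit — the physics half, engine-grade, taken as a
hypothesis).  The conclusion is VERBATIM the planner's registered text `Repair.__Registered.stub_far`
(`bc/line1r/ResponseLocalisation_repair_birth.lean`), so `stub_far := stub_far_of_farKernel h` closes that stub once `h` is
supplied; the floor hypothesis of the stub is used only to feed the kernel hypothesis its pinning witness (`v` itself,
compactly supported), and the relative tolerance is met with room (`η ≤ η(1+|∂_cQ2|)`). -/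
theorem stub_far_of_farKernel
    (hK : ∀ (G : Type) [Group G] [TopologicalSpace G] [IsTopologicalGroup G] [CompactSpace G],
      IsCompactSimpleLieGroup G →
      letI : MeasurableSpace G := borel G
      haveI : BorelSpace G := ⟨rfl⟩
      ∀ (r : LatticeRep G) (a : ℝ → ℝ), (∀ β, 0 < a β) → Filter.Tendsto a Filter.atTop (nhds 0) →
        (∃ (v₀ : 𝓢(EuclideanSpace ℝ (Fin 4), ℝ)) (ε β₅ Λ₅ : ℝ), HasCompactSupport v₀ ∧
          tsupport v₀ ⊆ {y : EuclideanSpace ℝ (Fin 4) | 0 < y 0} ∧ 0 < ε ∧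
          ∀ β : ℝ, β₅ ≤ β → ∀ L : ℕ, Λ₅ ≤ a β * L → ε ≤ Q2 G r β L (a β) (thetaTest 4 v₀) v₀) →
        ∃ A β₀ Λ₀ : ℝ, 0 ≤ A ∧ ∀ β : ℝ, β₀ ≤ β → ∀ L : ℕ, Λ₀ ≤ a β * L →
          ∀ x ∈ box 4 L, ∀ y ∈ box 4 L, ∀ z ∈ box 4 L,
            |torusK3 G r β L x y z| ≤
              A * (((1 + torusDist L x y) ^ 4)⁻¹ * ((1 + torusDist L x z) ^ 4)⁻¹ *
                ((1 + torusDist L y z) ^ 4)⁻¹)) :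
    ∀ (G : Type) [Group G] [TopologicalSpace G] [IsTopologicalGroup G] [CompactSpace G],
      IsCompactSimpleLieGroup G →
      letI : MeasurableSpace G := borel G
      haveI : BorelSpace G := ⟨rfl⟩
      ∀ (r : LatticeRep G) (a : ℝ → ℝ), (∀ β, 0 < a β) → Filter.Tendsto a Filter.atTop (nhds 0) →
        ∀ (p : EuclideanSpace ℝ (Fin 4)) (ρ ε : ℝ), 0 < ε → ∀ v : SchwartzMap (EuclideanSpace ℝ (Fin 4)) ℝ,
          tsupport v ⊆ Metric.closedBall p ρ → tsupport v ⊆ {y : EuclideanSpace ℝ (Fin 4) | 0 < y 0} →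
          (∫ y, |v y|) ≤ 1 →
          (∃ β₅ Λ₅ : ℝ, ∀ β : ℝ, β₅ ≤ β → ∀ L : ℕ, Λ₅ ≤ a β * L →
            ε ≤ Q2 G r β L (a β) (thetaTest 4 v) v) →
          ∀ η : ℝ, 0 < η → ∀ Λ : ℝ, 1 ≤ Λ → ∃ D : ℝ, 0 < D ∧ ∃ β₆ Λ₆ : ℝ, ∀ β : ℝ, β₆ ≤ β →
            ∀ L : ℕ, Λ₆ ≤ a β * L → ∀ l : ℝ, l ∈ Set.Icc 1 Λ →
              (∑ x ∈ box 4 L, (if D < ‖(l * a β) • siteToE x‖ then |respM G r β L (l * a β) v x| else 0)) ≤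
                η * (1 + |deriv (fun c : ℝ => Q2 G r c L (l * a β) (thetaTest 4 v) v) β|) := by
  intro G _ _ _ _ hG
  letI : MeasurableSpace G := borel G
  haveI : BorelSpace G := ⟨rfl⟩
  intro r a hpos hlim p ρ ε hε v hball hsupp _hL1 hfloor η hη Λ hΛ
  obtain ⟨β₅, Λ₅, hfl⟩ := hfloor
  have hcpt : HasCompactSupport (v : EuclideanSpace ℝ (Fin 4) → ℝ) :=
    (isCompact_closedBall p ρ).of_isClosed_subset (isClosed_tsupport _) hball
  obtain ⟨A, β₀, Λ₀, hA, hK3⟩ := hK G hG r a hpos hlim ⟨v, ε, β₅, Λ₅, hcpt, hsupp, hε, hfl⟩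
  obtain ⟨D, hD, s₀, hs₀, hfar⟩ := far_ceiling_of_gap G r v hball hsupp hA hη
  -- the unit eventually drops below `s₀ / Λ`
  have hΛ0 : 0 < Λ := by linarith
  have hev : ∀ᶠ β in Filter.atTop, a β < s₀ / Λ := hlim.eventually (gt_mem_nhds (by positivity))
  obtain ⟨β₁, hβ₁⟩ := Filter.eventually_atTop.mp hev
  refine ⟨D, hD, max β₀ β₁, max Λ₀ (2 * (‖p‖ + ρ)), fun β hβ L hL l hl => ?_⟩
  have hβ0 : β₀ ≤ β := le_trans (le_max_left _ _) hβ
  have hβ1 : β₁ ≤ β := le_trans (le_max_right _ _) hβ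
  have haβ : 0 < a β := hpos β
  have hs : 0 < l * a β := mul_pos (by linarith [hl.1]) haβ
  have hsle : l * a β ≤ s₀ := by
    have h1 : a β < s₀ / Λ := hβ₁ β hβ1
    have h2 : l * a β ≤ Λ * a β := mul_le_mul_of_nonneg_right hl.2 haβ.le
    have h3 : Λ * a β ≤ Λ * (s₀ / Λ) := mul_le_mul_of_nonneg_left h1.le hΛ0.le
    have h4 : Λ * (s₀ / Λ) = s₀ := by field_simp
    linarith
  have hLs : 2 * (‖p‖ + ρ) ≤ l * a β * L := by
    have h1 : 2 * (‖p‖ + ρ) ≤ a β * L := le_trans (le_max_right _ _) hL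
    have h2 : a β * L ≤ l * a β * L := by
      have : 0 ≤ a β * L := by positivity
      nlinarith [hl.1]
    linarith
  have hK3' := hK3 β hβ0 L (le_trans (le_max_left _ _) hL)
  have hmain := hfar (l * a β) hs hsle L hLs β hK3'
  calc (∑ x ∈ box 4 L, (if D < ‖(l * a β) • siteToE x‖ then |respM G r β L (l * a β) v x| else 0))
      ≤ η := hmain
    _ ≤ η * (1 + |deriv (fun c : ℝ => Q2 G r c L (l * a β) (thetaTest 4 v) v) β|) :=
        le_mul_of_one_le_right hη.le (by linarith [abs_nonneg (deriv (fun c : ℝ => Q2 G r c L (l * a β) (thetaTest 4 v) v) β)])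

end Summit.QuantumFields.YangMills.Cruxes.ResponseLocalisation.Far

end
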